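import Literature.Geometry.Kaehler.KaehlerSymbolIdentityProofs

/-!
# The symbol of `[∂̄*, L] - i∂` vanishes (Voisin, Lemma 6.6): operator form

`KaehlerSymbolIdentityProofs.lean` proves Voisin's Lemma 6.6 in symbol form for the *canonical*
Lefschetz-type operator `L_θ η = alternatizeUncurryFin (v ↦ θ v ∧ η)` of the covector family
`θ v = ½⟪Jv, ·⟫`. Here the same identity is stated for an *abstract* pair of operators
`L₂` (on `(j+1)`-forms) and `L₁` (on `j`-forms) of which only the algebra actually used is
assumed:

* `L₁` is additive and commutes with multiplication by `i`;
* the commutator with interior products has the Lefschetz shape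
  `ι_w (L₂ η) = (θ w - θᵗ w) ∧ η + L₁ (ι_w η)` (this is
  `Literature.LinearAlgebra.Alternating.curryLeft_lefschetz_eq` at the canonical family
  `v ↦ θ v ∧ η`, `[ι_w, ω ∧ ·] = (ι_w ω) ∧ ·`), for a real covector family `θ` with
  `θ w u = ½⟪Jw, u⟫`.

Conclusion (`symbol_dolbeaultBarAdjoint_lefschetz_sub_of`): for even `n`, `J` skew, `ξ` of type
`(1,0)`,
`-⋆_ℂ (ξ ∧ ⋆_ℂ (L₂ β)) + L₁ (⋆_ℂ (ξ ∧ ⋆_ℂ β)) - i (ξ ∧ β) = 0`, and the degree-`0` companion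
`symbol_dolbeaultBarAdjoint_lefschetz_zero_of`. This is the form in which the identity is applied
on a manifold, where the Lefschetz operator of the metric is written in model-space (chart)
types and only equalities of forms on the tangent space are transported. Mathematically nothing
is added to Lemma 6.6: Voisin (2002), §6.1.1, proof of Lemma 6.6 (p. 140) uses exactly
`∂̄* = -⋆∂⋆`, `⋆(ξ ∧ ⋆γ) = ±ι_ξ γ`, `[ι, ω∧] = (ιω)∧` and `ι_ξ ω = -iξ`; Huybrechts (2005),
Prop. 1.2.26, Prop. 3.1.12.

## References

* C. Voisin, *Hodge Theory and Complex Algebraic Geometry I* (2002), §6.1.1, Lemma 6.6, p. 140.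
  [Voisin2002]
* D. Huybrechts, *Complex Geometry* (2005), Prop. 1.2.26, Prop. 3.1.12. [Huybrechts2005]
-/

noncomputable section

open Module ContinuousAlternatingMap Function Complex
open Literature.LinearAlgebra.Alternating

namespace Literature.Geometry.Kaehler

set_option quotPrecheck false

/-- Complexification of a real covector. -/
local notation "𝔠₁" ξ:max => ContinuousLinearMap.comp Complex.ofRealCLM ξ

/-- The complexified Hodge star `⋆_ℂ η = ⋆(Re η) ⊗ 1 + i (⋆(Im η) ⊗ 1)` (pointwise value of
`MForm.cHodgeStar o h`). -/
local notation "⋆ℂ[" o ", " h "]" η:max =>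
  ContinuousLinearMap.compContinuousAlternatingMap Complex.ofRealCLM
      (hodgeStar o h (ContinuousLinearMap.compContinuousAlternatingMap Complex.reCLM η)) +
    Complex.I • ContinuousLinearMap.compContinuousAlternatingMap Complex.ofRealCLM
      (hodgeStar o h (ContinuousLinearMap.compContinuousAlternatingMap Complex.imCLM η))

/-- The complex contraction `ι_{u₁ + i u₂} η = u₁ ⌟ η + i (u₂ ⌟ η)`. -/
local notation "ιℂ[" u₁ ", " u₂ "]" η:max =>
  ContinuousAlternatingMap.curryLeft η u₁ + Complex.I • ContinuousAlternatingMap.curryLeft η u₂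

section Commutator

variable {V : Type*} [NormedAddCommGroup V] [NormedSpace ℝ V] {j : ℕ}

/-- **`[ι_ξ, L] = (ι_ξ ω) ∧ ·`, complexified, operator form** (positive degree): if
`ι_w (L₂ η) = (θ w - θᵗ w) ∧ η + L₁ (ι_w η)` for all `w`, with `L₁` additive and commuting with
`i`, then for the complex contraction `ι = u₁ ⌟ + i u₂ ⌟`,
`ι (L₂ η) = L₁ (ι η) + ((θ u₁ - θᵗ u₁) ⊗ 1 + i (θ u₂ - θᵗ u₂) ⊗ 1) ∧ η`.
[cite: Voisin2002, Lemma 6.6 (proof)] -/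
theorem curryLeftC_lefschetz_eq_of (θ : V →L[ℝ] V →L[ℝ] ℝ)
    (L₂ : V [⋀^Fin (j + 1)]→L[ℝ] ℂ → V [⋀^Fin (j + 1 + 1 + 1)]→L[ℝ] ℂ)
    (L₁ : V [⋀^Fin j]→L[ℝ] ℂ → V [⋀^Fin (j + 1 + 1)]→L[ℝ] ℂ)
    (hadd : ∀ η η', L₁ (η + η') = L₁ η + L₁ η') (hsmul : ∀ η, L₁ (I • η) = I • L₁ η)
    (hcomm : ∀ (η : V [⋀^Fin (j + 1)]→L[ℝ] ℂ) (w : V),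
      (L₂ η).curryLeft w = wedgeOne (θ w - θ.flip w) η + L₁ (η.curryLeft w))
    (η : V [⋀^Fin (j + 1)]→L[ℝ] ℂ) (u₁ u₂ : V) :
    ιℂ[u₁, u₂] (L₂ η) = L₁ (ιℂ[u₁, u₂] η) +
      wedgeOne (𝔠₁ (θ u₁ - θ.flip u₁) + I • 𝔠₁ (θ u₂ - θ.flip u₂)) η := by
  rw [hcomm η u₁, hcomm η u₂, hadd, hsmul, wedgeOne_add_left, wedgeOne_smul_left,
    wedgeOne_ofRealCLM_comp, wedgeOne_ofRealCLM_comp, smul_add]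
  abel

/-- **`[ι_ξ, L] = (ι_ξ ω) ∧ ·`, complexified, operator form, on `0`-forms**: if
`ι_w (L η) = (θ w - θᵗ w) ∧ η` then `ι (L η) = ((θ u₁ - θᵗ u₁) ⊗ 1 + i (θ u₂ - θᵗ u₂) ⊗ 1) ∧ η`.
[cite: Voisin2002, Lemma 6.6 (proof)] -/
theorem curryLeftC_lefschetz_zero_of (θ : V →L[ℝ] V →L[ℝ] ℝ)
    (L : V [⋀^Fin 0]→L[ℝ] ℂ → V [⋀^Fin (0 + 1 + 1)]→L[ℝ] ℂ)
    (hcomm : ∀ (η : V [⋀^Fin 0]→L[ℝ] ℂ) (w : V), (L η).curryLeft w = wedgeOne (θ w - θ.flip w) η)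
    (η : V [⋀^Fin 0]→L[ℝ] ℂ) (u₁ u₂ : V) :
    ιℂ[u₁, u₂] (L η) = wedgeOne (𝔠₁ (θ u₁ - θ.flip u₁) + I • 𝔠₁ (θ u₂ - θ.flip u₂)) η := by
  rw [hcomm η u₁, hcomm η u₂, wedgeOne_add_left, wedgeOne_smul_left, wedgeOne_ofRealCLM_comp,
    wedgeOne_ofRealCLM_comp]

end Commutator

section Symbol

open scoped RealInnerProductSpace

variable {V : Type*} [NormedAddCommGroup V] [InnerProductSpace ℝ V] [FiniteDimensional ℝ V]
  {n : ℕ} [Fact (finrank ℝ V = n)] (o : Orientation ℝ V (Fin n))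

omit [FiniteDimensional ℝ V] [Fact (finrank ℝ V = n)] in
/-- A covector family with `θ w u = ½⟪Jw, u⟫` is `½⟪J·, ·⟫`. [folklore] -/
theorem eq_half_innerSL_comp_of (J : V →L[ℝ] V) (θ : V →L[ℝ] V →L[ℝ] ℝ)
    (hθ : ∀ w u, θ w u = 2⁻¹ * ⟪J w, u⟫) :
    θ = (2⁻¹ : ℝ) • (innerSL ℝ (E := V)).comp J := by
  ext w u
  rw [hθ]
  simp

/-- **Voisin's Lemma 6.6 in symbol form, operator version (positive degree).** On an oriented
real inner product space of even dimension `n` with a skew operator `J` (`⟪Ju, v⟫ = -⟪u, Jv⟫`), let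
`L₂`, `L₁` be operators raising the degree of complex forms by `2` (on `(j+1)`- and `j`-forms)
such that `L₁` is additive and commutes with `i`, and
`ι_w (L₂ η) = (θ w - θᵗ w) ∧ η + L₁ (ι_w η)` for the covector family `θ w = ½⟪Jw, ·⟫` — the
commutation rule `[ι_w, ω ∧ ·] = (ι_w ω) ∧ ·` of the Lefschetz operator `ω ∧ ·` of
`ω(u, v) = ⟪Ju, v⟫`. Then for the complexified Hodge star `⋆_ℂ`, every complex covector `ξ` of
type `(1,0)` (`ξ(Jv) = iξ(v)`) and every complex `(j+1)`-form `β`,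

  `-⋆_ℂ (ξ ∧ ⋆_ℂ (L₂ β)) + L₁ (⋆_ℂ (ξ ∧ ⋆_ℂ β)) - i (ξ ∧ β) = 0`,

i.e. the first-order operator `[∂̄*, L] - i∂` (`∂̄* = -⋆∂⋆`) has vanishing symbol. Proof as for
`symbol_dolbeaultBarAdjoint_lefschetz_sub`: `⋆_ℂ(ξ ∧ ⋆_ℂ γ) = ι_ξ γ` in even dimension
(`cHodgeStar_wedgeOne_cHodgeStar`), the commutation rule, and `ι_ξ ω = -iξ`
(`innerSL_J_dual_re_add`). [cite: Voisin2002, §6.1.1 Lemma 6.6, p. 140] -/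
theorem symbol_dolbeaultBarAdjoint_lefschetz_sub_of (hn : Even n) (J : V →L[ℝ] V)
    (hJ : ∀ u v, ⟪J u, v⟫ = -⟪u, J v⟫) (ξ : V →L[ℝ] ℂ) (hξ : ∀ v, ξ (J v) = I * ξ v)
    (θ : V →L[ℝ] V →L[ℝ] ℝ) (hθ : ∀ w u, θ w u = 2⁻¹ * ⟪J w, u⟫) {j m₁ m₃ : ℕ}
    (h₁ : (j + 1 + 1 + 1) + m₁ = n) (h₂ : (m₁ + 1) + (j + 1 + 1) = n) (h₃ : (j + 1) + m₃ = n)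
    (h₄ : (m₃ + 1) + j = n)
    (L₂ : V [⋀^Fin (j + 1)]→L[ℝ] ℂ → V [⋀^Fin (j + 1 + 1 + 1)]→L[ℝ] ℂ)
    (L₁ : V [⋀^Fin j]→L[ℝ] ℂ → V [⋀^Fin (j + 1 + 1)]→L[ℝ] ℂ)
    (hadd : ∀ η η', L₁ (η + η') = L₁ η + L₁ η') (hsmul : ∀ η, L₁ (I • η) = I • L₁ η)
    (hcomm : ∀ (η : V [⋀^Fin (j + 1)]→L[ℝ] ℂ) (w : V),
      (L₂ η).curryLeft w = wedgeOne (θ w - θ.flip w) η + L₁ (η.curryLeft w))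
    (β : V [⋀^Fin (j + 1)]→L[ℝ] ℂ) :
    -⋆ℂ[o, h₂] (wedgeOne ξ (⋆ℂ[o, h₁] (L₂ β))) + L₁ (⋆ℂ[o, h₄] (wedgeOne ξ (⋆ℂ[o, h₃] β))) -
      I • wedgeOne ξ β = 0 := by
  have hθ' := eq_half_innerSL_comp_of J θ hθ
  subst hθ'
  set u₁ : V := (InnerProductSpace.toDual ℝ V).symm (reCLM.comp ξ) with hu₁
  set u₂ : V := (InnerProductSpace.toDual ℝ V).symm (imCLM.comp ξ) with hu₂
  rw [cHodgeStar_wedgeOne_cHodgeStar o h₁ h₂ ξ, cHodgeStar_wedgeOne_cHodgeStar o h₃ h₄ ξ,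
    neg_one_pow_mul_eq_one_of_even h₁ hn, neg_one_pow_mul_eq_one_of_even h₃ hn, one_smul, one_smul,
    curryLeftC_lefschetz_eq_of _ L₂ L₁ hadd hsmul hcomm β u₁ u₂, half_innerSL_J_sub_flip J hJ,
    half_innerSL_J_sub_flip J hJ, innerSL_J_dual_re_add J hJ ξ hξ, wedgeOne_neg_left,
    wedgeOne_smul_left]
  abel

/-- **Voisin's Lemma 6.6 in symbol form, operator version, degree `0`** (no middle term):
if `ι_w (L η) = (θ w - θᵗ w) ∧ η` on `0`-forms then `-⋆_ℂ (ξ ∧ ⋆_ℂ (L β)) - i (ξ ∧ β) = 0`.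
[cite: Voisin2002, §6.1.1 Lemma 6.6, p. 140] -/
theorem symbol_dolbeaultBarAdjoint_lefschetz_zero_of (hn : Even n) (J : V →L[ℝ] V)
    (hJ : ∀ u v, ⟪J u, v⟫ = -⟪u, J v⟫) (ξ : V →L[ℝ] ℂ) (hξ : ∀ v, ξ (J v) = I * ξ v)
    (θ : V →L[ℝ] V →L[ℝ] ℝ) (hθ : ∀ w u, θ w u = 2⁻¹ * ⟪J w, u⟫) {m₁ : ℕ}
    (h₁ : (0 + 1 + 1) + m₁ = n) (h₂ : (m₁ + 1) + (0 + 1) = n)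
    (L : V [⋀^Fin 0]→L[ℝ] ℂ → V [⋀^Fin (0 + 1 + 1)]→L[ℝ] ℂ)
    (hcomm : ∀ (η : V [⋀^Fin 0]→L[ℝ] ℂ) (w : V), (L η).curryLeft w = wedgeOne (θ w - θ.flip w) η)
    (β : V [⋀^Fin 0]→L[ℝ] ℂ) :
    -⋆ℂ[o, h₂] (wedgeOne ξ (⋆ℂ[o, h₁] (L β))) - I • wedgeOne ξ β = 0 := by
  have hθ' := eq_half_innerSL_comp_of J θ hθ
  subst hθ'
  set u₁ : V := (InnerProductSpace.toDual ℝ V).symm (reCLM.comp ξ) with hu₁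
  set u₂ : V := (InnerProductSpace.toDual ℝ V).symm (imCLM.comp ξ) with hu₂
  rw [cHodgeStar_wedgeOne_cHodgeStar o h₁ h₂ ξ, neg_one_pow_mul_eq_one_of_even h₁ hn, one_smul,
    curryLeftC_lefschetz_zero_of _ L hcomm β u₁ u₂, half_innerSL_J_sub_flip J hJ,
    half_innerSL_J_sub_flip J hJ, innerSL_J_dual_re_add J hJ ξ hξ, wedgeOne_neg_left,
    wedgeOne_smul_left]
  abel

end Symbol

end Literature.Geometry.Kaehler
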